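import Literature.MathematicalPhysics.QuantumFieldTheory.Balaban1983to89.B8SectERemainderTraceFree
import Literature.MathematicalPhysics.QuantumFieldTheory.Balaban1983to89.B8SpecialLinearTrace

/-!
# `Balaban1983to89.B8SectERemainderTraceFreeSU` — [Balaban1985RegularSpaces] Sect. E for `G = SU(N)`, `2 ≤ N ≤ 12`: [3]'s remainder
# `C′_j(u₁⁻¹, μ)(y)` is TRACE-FREE for trace-free `μ` — the binder `hCτ` of `B8SectETraceFree.sectE_traceFree` at `𝔸 = M_N(ℂ)`, `τ = tr`,
# with NO displayed group-theoretic hypothesis left (sub-row «G-B8-T2S», JOINT J-SU layer 3d)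

statement-level skeleton of published theorems with citation tags; proofs where landed; nothing here is a claim about the
Yang–Mills mass gap

T. Bałaban, *Spaces of regular gauge field configurations …*, Commun. Math. Phys. **99** (1985) 75–102 `[Balaban1985RegularSpaces]` ("B8"), p. 76
(«`G = SU(N)` … its Lie algebra `𝔤`»), (1.115)–(1.120) p. 96; T. Bałaban, *Averaging operations …*, Commun. Math. Phys. **98** (1985) 17–51
`[Balaban1985Averaging]` ("[3]"), p. 20, (213) p. 50.  STATUS: published, refereed.

CITATION HEADER (lean-in-tree rule).  Cell `lit-balaban`, seat `lit-balaban-t2s-1` (gen 0), sub-row «G-B8-T2S» (R3 `stmt-QuantumFields-19200`),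
JOINT J-SU layer 3d.  WHAT IS REPRODUCED.  `B8SectERemainderTraceFree.apply_Cnl_inv_of_axial` BY NAME at `𝔸 = M_N(ℂ)` (operator norm of the scope
`Matrix.Norms.L2Operator`, C⋆-structure by `letI` as in `B7Prop2SpecialUnitary`), `τ = B8SpecialUnitaryTrace.trCLM (Fin N)`, `G = specialUnitaryUnits (Fin N)`,
`H = B13Inv214OrbitSUN.slUnits N`, the hypotheses (T1), (H2), (H3), `AvgClosed`, `G ≤ H`, `G ≤ U(N)` supplied by `B8SpecialUnitaryTrace.trCLM_mul_comm`,
`B8SpecialLinearTrace.trCLM_mlog_eq_zero_of_mem_slUnits` (`N ≤ 25`), `expUnit_mem_slUnits`, `avgClosed_specialUnitary` (`N ≤ 12`),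
`specialUnitaryUnits_le_slUnits`, `B7Prop2SpecialUnitary.specialUnitaryUnits_le_unitaryUnits`.
* ★ `apply_Cnl_inv_of_axial_SU` — for `SU(N)`-valued `U₀`, `u₁` (`N ≤ 12`) in Theorem 4's regime, `tr C′_j(u₁⁻¹, μ)(y) = 0` for every trace-free `μ`
  in the (1.120)-set of the tower.

HONEST SCOPE.  An instantiation; no new analysis.  Count-neutral; N05 ∕ `stub_PV3A` NOT discharged; nothing continuum ∕ ℝ⁴ ∕ OS ∕ mass-gap ∕ Clay.
No `sorry`, no `def`, no `… : Prop` fact, no `instance`, no `notation`.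
-/

noncomputable section

open scoped Matrix.Norms.L2Operator
open NormedSpace

namespace Literature.MathematicalPhysics.QuantumFieldTheory.Balaban1983to89.B8SectERemainderTraceFreeSU

open B7Prop1Explicit (e expUnit)
open B7Prop2Explicit (unitaryUnits C0 c2')
open B7Prop2SpecialUnitary (specialUnitaryUnits specialUnitaryUnits_le_unitaryUnits)
open B7Prop1Local (InBox pdevOn)
open B7Prop3Flat (expCfg c3)
open B7Eq170Flat (cj)
open B7Prop10General (C6 C4G)
open B7Prop9Flat (C5')
open B8Ineq130 (tlo thi)
open B7Eq92Concrete (mgauge)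
open B8Eq119TwistedAxial (InAx Restr129)
open B8Eq1123Concrete (Cnl)
open B8SpecialUnitaryTrace (trCLM trCLM_mul_comm)
open B8SpecialLinearTrace (specialUnitaryUnits_le_slUnits trCLM_mlog_eq_zero_of_mem_slUnits expUnit_mem_slUnits avgClosed_specialUnitary)
open B8SectERemainderTraceFree (apply_Cnl_inv_of_axial)

-- `Site` alone could resolve to the torus sites of `Setup.lean`; re-export the `ℤ^d` sites of `B7Prop1Explicit`.
export B7Prop1Explicit (Site)

variable {d N : ℕ} [NeZero N] {L : ℕ} {U₀ : Site d → Fin d → (Matrix (Fin N) (Fin N) ℂ)ˣ} {α₀ α₄ : ℝ}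

/-- ★ **`tr C′_j(u₁⁻¹, μ)(y) = 0` FOR `SU(N)`-VALUED DATA, `N ≤ 12`** — the binder `hCτ` of `B8SectETraceFree.sectE_traceFree` ∕
`hFP_kLevel_of_sectE_local'_RD_traceFree` at `𝔸 = M_N(ℂ)`, `τ = tr`, with every group-theoretic hypothesis discharged: for Theorem 4's inductive `u₁`
(`SU(N)`-valued; `U₁^{u₁}U₀ ∈ Ax_k(𝔅_k, U₀)` and (1.29); `U₁ = e^{B}` unitary-valued with (1.69) on the towers; the full gauge-fixed field's
regularity `αP`; windows), an `SU(N)`-valued background `U₀` with (1.33) on the towers, at every `j ≤ k`, `y ∈ Λ_j` and every TRACE-FREE `μ` in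
the (1.120)-set of the tower `Bʲ(y)`.  (`B8SectERemainderTraceFree.apply_Cnl_inv_of_axial` with `G = SU(N)`, `H = SL(N, ℂ)`.)
[cite: Balaban1985RegularSpaces, (1.115) p.96, (1.120) p.96, p.76, (1.112) p.95; Balaban1985Averaging, p.20, Prop. 10 p.50, (213) p.50] -/
theorem apply_Cnl_inv_of_axial_SU (hN : N ≤ 12)
    {k : ℕ} (Λ : ℕ → Set (Site d)) {c αP : ℝ} {B : Site d → Fin d → Matrix (Fin N) (Fin N) ℂ} {u₁ : Site d → (Matrix (Fin N) (Fin N) ℂ)ˣ}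
    (hd : 1 ≤ d) (hL : 2 ≤ L) (hL1 : 1 ≤ L) (hU₀ : ∀ x κ, U₀ x κ ∈ specialUnitaryUnits (Fin N)) (hu₁ : ∀ x, u₁ x ∈ specialUnitaryUnits (Fin N))
    (hα : 0 < α₀) (hα3 : C0 d * α₀ ≤ 1 / 3) (hα4 : 4 * α₀ ≤ c2' d L) (hc : 0 ≤ c) (hα₄ : 0 < α₄)
    (hαP : 0 < αP) (hαP3 : C0 d * αP ≤ 1 / 3) (hαP2 : 2 * αP ≤ c2' d L)
    (hBu : ∀ (x : Site d) (κ : Fin d), expCfg B x κ ∈ unitaryUnits (Matrix (Fin N) (Fin N) ℂ))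
    (h33 : ∀ j, j ≤ k → ∀ y ∈ Λ j, pdevOn (tlo L y j) (thi L y j) U₀ < α₀ * (((L : ℝ) ^ j)⁻¹) ^ 2)
    (h69 : ∀ j, j ≤ k → ∀ y ∈ Λ j, ∀ (x : Site d) (κ : Fin d), InBox (tlo L y j) (thi L y j) x →
      InBox (tlo L y j) (thi L y j) (x + e κ) → ‖B x κ‖ ≤ c * ((L : ℝ) ^ j)⁻¹)
    (hP : ∀ j, j ≤ k → ∀ y ∈ Λ j, pdevOn (tlo L y j) (thi L y j) (expCfg B * U₀) < αP * (((L : ℝ) ^ j)⁻¹) ^ 2)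
    (hAx : InAx L k Λ U₀ (mgauge U₀ u₁ (expCfg B) * U₀)) (h129 : Restr129 L k Λ U₀ u₁)
    (hsmall : Real.exp (4 * (800 * ((d : ℝ) + 1) ^ 2 * ((d : ℝ) + 4)) * α₀) * (1 + 8 * (131072 * ((d : ℝ) + 1) ^ 2) * c) ≤ 2)
    (hc₃ : 2 * c ≤ c3 d L) (hsc : 2048 * (d : ℝ) * c ≤ 1) (hα₃' : 40 * d * c ≤ 1 / 50)
    (hs₁ : 10 * C6 d * (4 * α₄) ≤ 1) (hs₂ : 3000 * ((d : ℝ) + 1) * L * (4 * α₄) ≤ 1)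
    (hs₃ : C4G d L * (α₀ + 40 * d * c + 4 * α₄) ≤ 1)
    (hs₄ : 1024 * ((d : ℝ) + 1) * ((d : ℝ) + 4) * L ^ 2 * α₀ ≤ 1) (hs₅ : 32 * ((d : ℝ) + 1) ^ 2 * C6 d * L ^ 2 * α₀ ≤ 1)
    (hs₆ : 16 * d * C5' d * C6 d * (L : ℝ) ^ 2 * α₀ ≤ 1)
    (hprod : 2 * C6 d * (40 * d * c + 4 * α₄) ≤ 1 / 8) (h204w : C6 d * (4 * α₄) ≤ 1 / 8) :
    ∀ j, j ≤ k → ∀ y ∈ Λ j, ∀ μ : Site d → Matrix (Fin N) (Fin N) ℂ, (∀ x, trCLM (Fin N) (μ x) = 0) →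
      (∀ x : Site d, InBox (tlo L y j) (thi L y j) x → ‖μ x‖ < α₄) →
      (∀ (x : Site d) (κ : Fin d), InBox (tlo L y j) (thi L y j) x → InBox (tlo L y j) (thi L y j) (x + e κ) →
        ‖cj (U₀ x κ) (μ (x + e κ)) - μ x‖ < α₄ * ((L : ℝ) ^ j)⁻¹) →
      trCLM (Fin N) (Cnl L U₀ u₁⁻¹ j μ y) = 0 := by
  letI : CStarAlgebra (Matrix (Fin N) (Fin N) ℂ) := {}
  have hu₁' : ∀ x, u₁ x ∈ B13Inv214OrbitSUN.slUnits N := fun x => specialUnitaryUnits_le_slUnits (hu₁ x)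
  exact apply_Cnl_inv_of_axial (trCLM (Fin N)) trCLM_mul_comm
    (fun g hg hs => trCLM_mlog_eq_zero_of_mem_slUnits (hN.trans (by norm_num)) hg hs) (fun S hS => expUnit_mem_slUnits hS)
    (avgClosed_specialUnitary d L hN) specialUnitaryUnits_le_slUnits specialUnitaryUnits_le_unitaryUnits Λ hd hL hL1 hU₀ hu₁' hα hα3 hα4
    hc hα₄ hαP hαP3 hαP2 hBu h33 h69 hP hAx h129 hsmall hc₃ hsc hα₃' hs₁ hs₂ hs₃ hs₄ hs₅ hs₆ hprod h204w

#print axioms apply_Cnl_inv_of_axial_SU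

end Literature.MathematicalPhysics.QuantumFieldTheory.Balaban1983to89.B8SectERemainderTraceFreeSU

end
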